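import Mathlib
import Literature.Analysis.OperatorTheory.Enflo2023.Basic
import Literature.Analysis.OperatorTheory.Enflo2023.Vy
import Literature.Analysis.OperatorTheory.Enflo2023.TypeDichotomy
import Literature.Analysis.OperatorTheory.Enflo2023.Type2LargeL
import Literature.Analysis.OperatorTheory.Enflo2023.Type2Sensitivity
import Literature.Analysis.OperatorTheory.Enflo2023.Type2PrintedD2
import HarnessLib

/-!
# Enflo 2023, v2 pp.7, 20–22: a type-2 operator under which (47) as printed fails (referee divergence D19)

Source under adjudication: Per H. Enflo, *On the invariant subspace problem in Hilbert spaces*, arXiv:2305.15442 (v1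
2023, v2 2024), bib key `Enflo2023` — a CLAIMED proof of the invariant subspace problem for operators on a separable
Hilbert space.  This file is part of the kernel-tight typing of the manuscript by the b2b-enflo repair cell
(formaliser 2, Part B: (28)–(47), the limiting argument and the final deduction).  It records what FOLLOWS (proved
implications from the manuscript's displayed hypotheses) and, where a step does not follow, the typed inference
together with its refutation.  NOTHING here asserts that the manuscript's main theorem holds; no declaration concludes
the invariant subspace problem for an arbitrary operator.  Value (BLOCK-2b): theorems / refutations of typed
inferences about a text — not progress on the problem.

EnfloISP — Part B (formaliser 2), companion of `Type2PrintedD2.lean` (STEPS row B30, referee divergence D19).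
`Type2PrintedD2.printed_eq47_fails_D2` refutes (47) as printed for ANY strict contraction `‖T‖ ≤ 1/10`, any unit
`x₀` and any unit vectors `e_n ⊥ x₀`, with data obeying the norm / angle constraints of the type-2 pipeline
(`‖s_n‖ ≤ 2`, `‖y‖ ≤ 1`, `y ≠ 0`, `Re⟨u₀, y⟩ ≥ 1/100`).  Two further properties of the pipeline's data involve the
operator — (20) "`⟨T^j y'_n, y'_n⟩ → 0` for `j ≥ m`" in the split form
`⟨T^j y, y⟩ + ⟨T^j s_n, s_n⟩ → 0` (`Type2.eq20_of_type2`) and the weak nullity of `s_n` — and the pipeline's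
hypotheses on `T` are: `‖T‖ < 1`, `T*` injective, `T` of type 2 (`Referee.Type2`, v2 p.7).  This file exhibits ONE
CONCRETE OPERATOR meeting all of them — and every STANDING hypothesis of v2 pp.1–2 (`T` one-to-one, not onto, `R(T)`
dense, `0 ∈ σ(T)`, `‖T‖ = 10⁻²⁰`) — under which the `D = 2` data still refute (47) as printed:

* `H := ℓ²(ℤ)` (`ℓ2Z`), `T_w := 10⁻²⁰ · W` with `W` the WEIGHTED BILATERAL (backward) SHIFT `(W a)_i = ω_i a_{i+1}`,
  weights `ω_i = 1` for `i ≥ 0` and `ω_{−(n+1)} = 1/(n+2)`: `T_w` is one-to-one (`Tw_injective`, weights `≠ 0`), has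
  dense range (`Tw_denseRange`: `R(T_w)^⊥ = ker T_w* = 0`), is not onto and `0 ∈ σ(T_w)` (`Tw_not_surjective`,
  `zero_mem_spectrum_Tw`: the vector `(ω_i [i < 0])_i` has the non-`ℓ²` candidate preimage `a_k = 1, k ≤ 0`),
  `‖T_w‖ = 10⁻²⁰` exactly (`norm_Tw`, attained at `e_1 ↦ 10⁻²⁰ e_0`), `T_w* = 10⁻²⁰ W'` with
  `(W' b)_i = ω_{i−1} b_{i−1}` is injective (`adjoint_W`, `adjoint_Tw_injective`), and `T_w` is of TYPE 2
  (`type2_Tw`: for a unit vector `u₀` take `y :=` a finite truncation of `u₀` with `‖u₀ − y‖ < 1/4`, so that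
  `Re⟨u₀, y⟩ ≥ ‖y‖/100`, supported in `[−R, R]`, and `m := 2R + 1`; powers of `T_w` are weighted translations
  `(T_w^j a)_i = c_{i,j} a_{i+j}` (`Tw_pow_apply`), so for `j ≥ m` every term of `⟨T_w^j y, y⟩ = Σ_i c̄ ȳ_{i+j} y_i`
  vanishes and `|⟨T_w^j y, y⟩| = 0 ≤ δ‖y‖²` for every `δ > 0`);
* `x₀ := u₀ := e_0`, `e_n := e_{n+1}` (standard unit vectors of `ℓ²(ℤ)`): `y = (12/13) e_0`, `s'_0 = −(25/13) e_0`,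
  `s'_n = (5/13) e_{n+1}`; (20) holds exactly from `m = 1` (`⟨T_w^j e_k, e_k⟩ = c̄_{k,j} (e_k)_{k+j} = 0` for
  `j ≥ 1`, `inner_eZ_Tw_pow_eZ`), and `s'_n` is weakly null (`⟨v, s'_n⟩ = (5/13)·conj(v_{n+1}) → 0`);
* `inPipeline_printed_eq47_fails`: all standing hypotheses, all hypotheses of `Type2.eq47_of_type2` and every data
  conjunct of its second disjunct (with `m = 1`) hold for `(T_w, u₀ = x₀ = e_0, y, s')`, the PRINTED threshold is
  exactly `L₀ = 12/25` with `M(L₀) = ∞`, and the printed conclusion of (47) fails (`(εθ) ≥ 1/8` for every minimal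
  move at every index and every radius in `[0.3, 0.4]`).

So the misstatement of (47) located in `Type2Sensitivity.lean` is visible on a genuine type-2 operator satisfying
everything the manuscript assumes up to p.22, with data of exactly the pipeline's shape; it is not an artefact of a
large `D` (D19 closed).  `T_w` is of course no counterexample to anything about invariant subspaces (e.g. the closed
span of `{e_k : k ≤ 0}` is invariant); it only certifies that the printed inference "M(L₀) = ∞ ⇒ arbitrarily small
`(εθ)`" does not follow from the hypotheses available at that point of the text.  The repaired (47) (`Type2.eq47`,
eventual quantifier) is a theorem for every strict contraction, this one included.
Dictionary: paper `⟨u, v⟩` (linear in `u`) = Mathlib `⟪v, u⟫_ℂ`; `e_n` = `lp.single 2 n 1` (`n ∈ ℤ`); `T^j` as a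
map = `T ^ j` (= `(⇑T)^[j]`, `ContinuousLinearMap.coe_pow'`); the move coefficients `ℓ(T) = Σ a_j T^j` live in
`Vy.ℓ2 = ℓ²(ℕ)` as everywhere in the record (`Vy.V`).
STATUS: all claims of this docstring kernel-checked (zero sorry); verdict on the manuscript unchanged.
-/

open scoped InnerProductSpace
open Filter Topology RCLike

namespace Literature.Analysis.OperatorTheory.Enflo2023

namespace Type2

namespace ShiftModel

/-! ### `ℓ²(ℤ)` and its standard unit vectors -/

/-- `ℓ²(ℤ, ℂ)` as Mathlib's `lp`. [folklore] -/
abbrev ℓ2Z : Type := lp (fun _ : ℤ => ℂ) 2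

/-- `Σ_i |a_i|² = ‖a‖²` on `ℓ²(ℤ)`. [folklore] -/
lemma hasSum_sq (a : ℓ2Z) : HasSum (fun i => ‖a i‖ ^ 2) (‖a‖ ^ 2) := by
  have h := lp.hasSum_norm (by norm_num : 0 < (2 : ENNReal).toReal) a
  simp only [ENNReal.toReal_ofNat, Real.rpow_two] at h
  exact h

/-- `Σ_i |a_i|²` converges on `ℓ²(ℤ)`. [folklore] -/
lemma summable_sq (a : ℓ2Z) : Summable (fun i => ‖a i‖ ^ 2) := (hasSum_sq a).summable

/-- The standard unit vector `e_n ∈ ℓ²(ℤ)`. [folklore] -/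
noncomputable def eZ (n : ℤ) : ℓ2Z := lp.single 2 n (1 : ℂ)

/-- The standard unit vectors are orthonormal. [folklore] -/
lemma orthonormal_eZ : Orthonormal ℂ eZ := by
  classical
  rw [orthonormal_iff_ite]
  intro i j
  unfold eZ
  rw [lp.inner_single_left, lp.single_apply]
  by_cases h : i = j
  · subst h
    simp
  · rw [Pi.single_eq_of_ne h]
    simp [h]

/-- `‖e_n‖ = 1`. [folklore] -/
lemma norm_eZ (n : ℤ) : ‖eZ n‖ = 1 := orthonormal_eZ.1 n

/-- `⟨e_m, e_n⟩ = 0` for `m ≠ n`. [folklore] -/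
lemma inner_eZ_of_ne {m n : ℤ} (h : m ≠ n) : ⟪eZ m, eZ n⟫_ℂ = 0 := orthonormal_eZ.2 h

/-- `(e_n)_n = 1`. [folklore] -/
lemma eZ_apply_self (n : ℤ) : eZ n n = 1 := by
  classical
  unfold eZ
  rw [lp.single_apply, Pi.single_eq_same]

/-- `(e_n)_i = 0` for `i ≠ n`. [folklore] -/
lemma eZ_apply_of_ne {n i : ℤ} (h : i ≠ n) : eZ n i = 0 := by
  classical
  unfold eZ
  rw [lp.single_apply, Pi.single_eq_of_ne h]

/-- The example's `e_n := e_{n+1}`, `n ∈ ℕ` (unit, orthogonal to `x₀ = e_0`). [folklore] -/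
noncomputable def eP (n : ℕ) : ℓ2Z := eZ ((n : ℤ) + 1)

/-- `eP n = e_{n+1}`. [folklore] -/
@[simp] lemma eP_apply (n : ℕ) : eP n = eZ ((n : ℤ) + 1) := rfl

/-- `‖e_{n+1}‖ = 1`. [folklore] -/
lemma norm_eP (n : ℕ) : ‖eP n‖ = 1 := norm_eZ _

/-- `⟨e_0, e_{n+1}⟩ = 0`. [folklore] -/
lemma inner_eZ_zero_eP (n : ℕ) : ⟪eZ 0, eP n⟫_ℂ = 0 := inner_eZ_of_ne (by omega)

/-- Coordinates of an `ℓ²(ℤ)` sequence tend to `0` along `n ↦ n + 1`, `n ∈ ℕ`. [folklore] -/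
lemma tendsto_apply_succ_zero (v : ℓ2Z) : Tendsto (fun n : ℕ => v ((n : ℤ) + 1)) atTop (𝓝 0) := by
  have h0 : Summable (fun n : ℕ => ‖v (n : ℤ)‖ ^ 2) :=
    (summable_int_iff_summable_nat_and_neg.1 (summable_sq v)).1
  have h1 : Tendsto (fun n : ℕ => ‖v ((n : ℤ) + 1)‖ ^ 2) atTop (𝓝 0) := by
    have h := ((summable_nat_add_iff 1).2 h0).tendsto_atTop_zero
    simpa [Nat.cast_add, Nat.cast_one] using h
  have h2 : Tendsto (fun n : ℕ => ‖v ((n : ℤ) + 1)‖) atTop (𝓝 0) := by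
    have h3 := h1.sqrt
    rw [Real.sqrt_zero] at h3
    refine h3.congr' (Eventually.of_forall fun n => ?_)
    exact Real.sqrt_sq (norm_nonneg _)
  exact tendsto_zero_iff_norm_tendsto_zero.2 h2

/-! ### Weighted composition operators on `ℓ²(ℤ)` and the model's weighted bilateral shift -/

/-- The weights `ω_i`: `1` for `i ≥ 0` and `1/(n+2)` for `i = −(n+1)` (positive, `≤ 1`, `inf = 0`). [folklore] -/
noncomputable def ω (i : ℤ) : ℝ := 1 / (((-i).toNat : ℝ) + 1)

/-- `ω_i > 0`. [folklore] -/
lemma ω_pos (i : ℤ) : 0 < ω i := by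
  unfold ω
  positivity

/-- `ω_i ≤ 1`. [folklore] -/
lemma ω_le_one (i : ℤ) : ω i ≤ 1 := by
  unfold ω
  rw [div_le_one (by positivity)]
  linarith [((-i).toNat.cast_nonneg : (0 : ℝ) ≤ ((-i).toNat : ℝ))]

/-- `0 ≤ ω_i ≤ 1`. [folklore] -/
lemma ω_nonneg_le (i : ℤ) : 0 ≤ ω i ∧ ω i ≤ 1 := ⟨(ω_pos i).le, ω_le_one i⟩

/-- `ω_i = 1` for `i ≥ 0`. [folklore] -/
lemma ω_of_nonneg {i : ℤ} (hi : 0 ≤ i) : ω i = 1 := by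
  unfold ω
  rw [show (-i).toNat = 0 by omega]
  simp

/-- `ω_{−(n+1)} = 1/(n+2)`. [folklore] -/
lemma ω_neg_succ (n : ℕ) : ω (-((n : ℤ) + 1)) = 1 / ((n : ℝ) + 2) := by
  unfold ω
  rw [show (-(-((n : ℤ) + 1))).toNat = n + 1 by omega]
  push_cast
  ring

/-- `ω_{−n} = 1/(n+1)` for `n ∈ ℕ`. [folklore] -/
lemma ω_neg_natCast (n : ℕ) : ω (-(n : ℤ)) = 1 / ((n : ℝ) + 1) := by
  unfold ω
  rw [show (-(-(n : ℤ))).toNat = n by omega]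

/-- The sequence `i ↦ w_i · a_{e(i)}`: a weighted composition with a bijection `e` of `ℤ`. [folklore] -/
def wcompSeq (w : ℤ → ℝ) (e : ℤ ≃ ℤ) (a : ℤ → ℂ) : ℤ → ℂ := fun i => (w i : ℂ) * a (e i)

/-- `wcompSeq w e a i = w_i a_{e(i)}`. [folklore] -/
@[simp] lemma wcompSeq_apply (w : ℤ → ℝ) (e : ℤ ≃ ℤ) (a : ℤ → ℂ) (i : ℤ) :
    wcompSeq w e a i = (w i : ℂ) * a (e i) := rfl

/-- Weights in `[0, 1]` keep a reindexed `ℓ²` sequence in `ℓ²`. [folklore] -/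
lemma memℓp_wcompSeq (w : ℤ → ℝ) (hw : ∀ i, 0 ≤ w i ∧ w i ≤ 1) (e : ℤ ≃ ℤ) (a : ℓ2Z) :
    Memℓp (wcompSeq w e a) 2 := by
  rw [memℓp_gen_iff (by norm_num : 0 < (2 : ENNReal).toReal)]
  simp only [ENNReal.toReal_ofNat, Real.rpow_two, wcompSeq_apply]
  have hs : Summable (fun i => ‖a (e i)‖ ^ 2) :=
    (e.summable_iff (f := fun j => ‖a j‖ ^ 2)).2 (summable_sq a)
  refine Summable.of_nonneg_of_le (fun i => sq_nonneg _) (fun i => ?_) hs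
  rw [norm_mul, Complex.norm_real, Real.norm_of_nonneg (hw i).1, mul_pow]
  calc w i ^ 2 * ‖a (e i)‖ ^ 2 ≤ 1 * ‖a (e i)‖ ^ 2 := by
        gcongr
        exact pow_le_one₀ (hw i).1 (hw i).2
    _ = ‖a (e i)‖ ^ 2 := one_mul _

/-- The weighted composition as a linear map on `ℓ²(ℤ)`. [folklore] -/
noncomputable def wcompLin (w : ℤ → ℝ) (hw : ∀ i, 0 ≤ w i ∧ w i ≤ 1) (e : ℤ ≃ ℤ) : ℓ2Z →ₗ[ℂ] ℓ2Z where
  toFun a := ⟨wcompSeq w e a, memℓp_wcompSeq w hw e a⟩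
  map_add' a b := by
    apply lp.ext
    funext j
    show (w j : ℂ) * (a (e j) + b (e j)) = (w j : ℂ) * a (e j) + (w j : ℂ) * b (e j)
    ring
  map_smul' c a := by
    apply lp.ext
    funext j
    show (w j : ℂ) * (c * a (e j)) = c * ((w j : ℂ) * a (e j))
    ring

/-- `(wcompLin a)_i = w_i a_{e(i)}`. [folklore] -/
@[simp] lemma wcompLin_apply (w : ℤ → ℝ) (hw : ∀ i, 0 ≤ w i ∧ w i ≤ 1) (e : ℤ ≃ ℤ) (a : ℓ2Z) (i : ℤ) :
    wcompLin w hw e a i = (w i : ℂ) * a (e i) := rfl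

/-- `‖wcompLin a‖ ≤ ‖a‖`. [folklore] -/
lemma norm_wcompLin_le (w : ℤ → ℝ) (hw : ∀ i, 0 ≤ w i ∧ w i ≤ 1) (e : ℤ ≃ ℤ) (a : ℓ2Z) :
    ‖wcompLin w hw e a‖ ≤ ‖a‖ := by
  have h1 : HasSum (fun i => ‖a (e i)‖ ^ 2) (‖a‖ ^ 2) :=
    (e.hasSum_iff (f := fun j => ‖a j‖ ^ 2)).2 (hasSum_sq a)
  have h2 : ‖wcompLin w hw e a‖ ^ 2 ≤ ‖a‖ ^ 2 := by
    refine hasSum_le (fun i => ?_) (hasSum_sq (wcompLin w hw e a)) h1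
    rw [wcompLin_apply, norm_mul, Complex.norm_real, Real.norm_of_nonneg (hw i).1, mul_pow]
    calc w i ^ 2 * ‖a (e i)‖ ^ 2 ≤ 1 * ‖a (e i)‖ ^ 2 := by
          gcongr
          exact pow_le_one₀ (hw i).1 (hw i).2
      _ = ‖a (e i)‖ ^ 2 := one_mul _
  exact (pow_le_pow_iff_left₀ (norm_nonneg _) (norm_nonneg _) two_ne_zero).1 h2

/-- **Weighted composition operator** `(W a)_i = w_i a_{e(i)}` on `ℓ²(ℤ)` (weights in `[0,1]`, `e` a bijection),
a contraction. [folklore] -/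
noncomputable def wcomp (w : ℤ → ℝ) (hw : ∀ i, 0 ≤ w i ∧ w i ≤ 1) (e : ℤ ≃ ℤ) : ℓ2Z →L[ℂ] ℓ2Z :=
  (wcompLin w hw e).mkContinuous 1 fun a => by
    rw [one_mul]
    exact norm_wcompLin_le w hw e a

/-- `(wcomp a)_i = w_i a_{e(i)}`. [folklore] -/
@[simp] lemma wcomp_apply (w : ℤ → ℝ) (hw : ∀ i, 0 ≤ w i ∧ w i ≤ 1) (e : ℤ ≃ ℤ) (a : ℓ2Z) (i : ℤ) :
    wcomp w hw e a i = (w i : ℂ) * a (e i) := rfl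

/-- `‖wcomp‖ ≤ 1`. [folklore] -/
lemma norm_wcomp_le (w : ℤ → ℝ) (hw : ∀ i, 0 ≤ w i ∧ w i ≤ 1) (e : ℤ ≃ ℤ) : ‖wcomp w hw e‖ ≤ 1 :=
  LinearMap.mkContinuous_norm_le _ zero_le_one _

/-- A weighted composition operator with non-zero weights is injective. [folklore] -/
lemma wcomp_injective (w : ℤ → ℝ) (hw : ∀ i, 0 ≤ w i ∧ w i ≤ 1) (hw0 : ∀ i, w i ≠ 0) (e : ℤ ≃ ℤ) :
    Function.Injective (wcomp w hw e) := by
  refine (injective_iff_map_eq_zero _).2 fun a ha => ?_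
  apply lp.ext
  funext k
  rw [lp.coeFn_zero, Pi.zero_apply]
  have hk := congrArg (fun g : ℓ2Z => g (e.symm k)) ha
  simp only [wcomp_apply, Equiv.apply_symm_apply, lp.coeFn_zero, Pi.zero_apply, mul_eq_zero,
    Complex.ofReal_eq_zero] at hk
  exact hk.resolve_left (hw0 _)

/-- **The model's shift** `W`: `(W a)_i = ω_i a_{i+1}` — a weighted bilateral backward shift on `ℓ²(ℤ)`. [folklore] -/
noncomputable def W : ℓ2Z →L[ℂ] ℓ2Z := wcomp ω ω_nonneg_le (Equiv.addRight 1)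

/-- `(W a)_i = ω_i a_{i+1}`. [folklore] -/
lemma W_apply (a : ℓ2Z) (i : ℤ) : W a i = (ω i : ℂ) * a (i + 1) := rfl

/-- `W'`: `(W' b)_i = ω_{i−1} b_{i−1}` (this is `W*`). [folklore] -/
noncomputable def W' : ℓ2Z →L[ℂ] ℓ2Z :=
  wcomp (fun i => ω (i - 1)) (fun i => ω_nonneg_le (i - 1)) (Equiv.subRight 1)

/-- `(W' b)_i = ω_{i−1} b_{i−1}`. [folklore] -/
lemma W'_apply (b : ℓ2Z) (i : ℤ) : W' b i = (ω (i - 1) : ℂ) * b (i - 1) := rfl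

/-- `W` is injective (all weights are non-zero). [folklore] -/
theorem W_injective : Function.Injective W := wcomp_injective ω ω_nonneg_le (fun i => (ω_pos i).ne') _

/-- `W'` is injective (all weights are non-zero). [folklore] -/
theorem W'_injective : Function.Injective W' :=
  wcomp_injective (fun i => ω (i - 1)) (fun i => ω_nonneg_le (i - 1)) (fun i => (ω_pos (i - 1)).ne') _

/-- **`W* = W'`**: `⟨W' a, b⟩ = Σ_i ω_{i−1} conj(a_{i−1}) b_i = Σ_k conj(a_k) ω_k b_{k+1} = ⟨a, W b⟩`. [folklore] -/
theorem adjoint_W : ContinuousLinearMap.adjoint W = W' := by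
  symm
  rw [ContinuousLinearMap.eq_adjoint_iff]
  intro a b
  rw [lp.inner_eq_tsum, lp.inner_eq_tsum, ← (Equiv.addRight (1 : ℤ)).tsum_eq]
  refine tsum_congr fun k => ?_
  simp only [Equiv.coe_addRight, W'_apply, W_apply, add_sub_cancel_right, RCLike.inner_apply', map_mul,
    Complex.conj_ofReal]
  ring

/-- `W e_1 = e_0` (`ω_0 = 1`). [folklore] -/
lemma W_eZ_one : W (eZ 1) = eZ 0 := by
  apply lp.ext
  funext i
  rw [W_apply]
  by_cases hi : i = 0
  · subst hi
    rw [show (0 : ℤ) + 1 = 1 from rfl, eZ_apply_self, eZ_apply_self, ω_of_nonneg le_rfl]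
    push_cast
    ring
  · rw [eZ_apply_of_ne hi, eZ_apply_of_ne (show i + 1 ≠ 1 by omega), mul_zero]

/-- The vector `b` with `b_i = ω_i` for `i < 0` and `b_i = 0` for `i ≥ 0`. [folklore] -/
noncomputable def bSeq (i : ℤ) : ℂ := if i < 0 then (ω i : ℂ) else 0

/-- `b ∈ ℓ²(ℤ)` (`Σ_n (n+2)^{-2} < ∞`). [folklore] -/
lemma memℓp_bSeq : Memℓp bSeq 2 := by
  rw [memℓp_gen_iff (by norm_num : 0 < (2 : ENNReal).toReal)]
  simp only [ENNReal.toReal_ofNat, Real.rpow_two]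
  rw [summable_int_iff_summable_nat_and_neg]
  constructor
  · have h : (fun n : ℕ => ‖bSeq (n : ℤ)‖ ^ 2) = fun _ => 0 := by
      funext n
      rw [bSeq, if_neg (by omega)]
      simp
    rw [h]
    exact summable_zero
  · have hs : Summable (fun n : ℕ => 1 / ((n : ℝ) + 1) ^ 2) := by
      have := (summable_nat_add_iff 1).mpr (Real.summable_one_div_nat_pow.mpr one_lt_two)
      simpa [Nat.cast_add, Nat.cast_one] using this
    refine Summable.of_nonneg_of_le (fun n => sq_nonneg _) (fun n => ?_) hs
    rcases Nat.eq_zero_or_pos n with rfl | hn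
    · rw [bSeq, if_neg (by omega)]
      simp
    · rw [bSeq, if_pos (by omega), Complex.norm_real, Real.norm_of_nonneg (ω_pos _).le, ω_neg_natCast, div_pow,
        one_pow]

/-- `b` as an element of `ℓ²(ℤ)`. [folklore] -/
noncomputable def bVec : ℓ2Z := ⟨bSeq, memℓp_bSeq⟩

/-- Coordinates of `b`. [folklore] -/
lemma bVec_apply (i : ℤ) : bVec i = bSeq i := rfl

/-- **`W` is not surjective**: `b = (ω_i [i < 0])_i` has the only candidate preimage `(…, 1, 1, 1, 0, 0, …)`
(`a_k = 1` for `k ≤ 0`), which is not in `ℓ²`. [folklore] -/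
theorem W_not_surjective : ¬ Function.Surjective W := by
  intro hs
  obtain ⟨a, ha⟩ := hs bVec
  have hk : ∀ n : ℕ, a (-(n : ℤ)) = 1 := by
    intro n
    have h := congrArg (fun g : ℓ2Z => g (-((n : ℤ) + 1))) ha
    simp only [W_apply, bVec_apply, bSeq] at h
    rw [if_pos (by omega), show -((n : ℤ) + 1) + 1 = -(n : ℤ) by ring] at h
    have hd : (ω (-((n : ℤ) + 1)) : ℂ) ≠ 0 := Complex.ofReal_ne_zero.mpr (ω_pos _).ne'
    have h' : (ω (-((n : ℤ) + 1)) : ℂ) * a (-(n : ℤ)) = (ω (-((n : ℤ) + 1)) : ℂ) * 1 := by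
      rw [mul_one]
      exact h
    exact mul_left_cancel₀ hd h'
  have hsum : Summable (fun n : ℕ => ‖a (-(n : ℤ))‖ ^ 2) :=
    (summable_int_iff_summable_nat_and_neg.1 (summable_sq a)).2
  have ht := hsum.tendsto_atTop_zero
  simp only [hk, norm_one, one_pow] at ht
  exact zero_ne_one (tendsto_nhds_unique ht tendsto_const_nhds)

/-! ### The model operator `T_w = 10⁻²⁰ · W` and the manuscript's standing hypotheses -/

/-- **The model operator** `T_w := 10⁻²⁰ · W` on `ℓ²(ℤ)`: `(T_w a)_i = 10⁻²⁰ ω_i a_{i+1}`. [folklore] -/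
noncomputable def Tw : ℓ2Z →L[ℂ] ℓ2Z := ((1 / 10 ^ 20 : ℝ) : ℂ) • W

/-- `(T_w a)_i = 10⁻²⁰ ω_i a_{i+1}`. [folklore] -/
lemma Tw_apply (a : ℓ2Z) (i : ℤ) : Tw a i = ((1 / 10 ^ 20 : ℝ) : ℂ) * ((ω i : ℂ) * a (i + 1)) := by
  rw [Tw, smul_apply, lp.coeFn_smul, Pi.smul_apply, W_apply, smul_eq_mul]

/-- `‖T_w‖ ≤ 10⁻²⁰`. [folklore] -/
lemma norm_Tw_le : ‖Tw‖ ≤ 1 / 10 ^ 20 := by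
  rw [Tw, norm_smul, Complex.norm_real, Real.norm_of_nonneg (by positivity)]
  calc (1 / 10 ^ 20 : ℝ) * ‖W‖ ≤ 1 / 10 ^ 20 * 1 := by
        gcongr
        exact norm_wcomp_le _ _ _
    _ = 1 / 10 ^ 20 := mul_one _

/-- **`‖T_w‖ = 10⁻²⁰`** — the manuscript's normalisation of `‖T‖` (v2 p.2), attained at `e_1 ↦ 10⁻²⁰ e_0`. [cite: Enflo2023, v2 p.2 (normalisation ‖T‖ = 10⁻²⁰)] -/
theorem norm_Tw : ‖Tw‖ = 1 / 10 ^ 20 := by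
  refine le_antisymm norm_Tw_le ?_
  have h1 := Tw.le_opNorm (eZ 1)
  have h2 : Tw (eZ 1) = ((1 / 10 ^ 20 : ℝ) : ℂ) • eZ 0 := by
    rw [Tw, smul_apply, W_eZ_one]
  rw [h2, norm_smul, norm_eZ, norm_eZ, mul_one, mul_one, Complex.norm_real,
    Real.norm_of_nonneg (by positivity)] at h1
  exact h1

/-- `‖T_w‖ ≤ 1/10` (what `Type2PrintedD2.printed_eq47_fails_D2` needs). [folklore] -/
lemma norm_Tw_le_tenth : ‖Tw‖ ≤ 1 / 10 := norm_Tw_le.trans (by norm_num)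

/-- `‖T_w‖ < 1`. [folklore] -/
lemma norm_Tw_lt_one : ‖Tw‖ < 1 := norm_Tw_le.trans_lt (by norm_num)

/-- `T_w* = 10⁻²⁰ · W'`. [folklore] -/
theorem adjoint_Tw : ContinuousLinearMap.adjoint Tw = ((1 / 10 ^ 20 : ℝ) : ℂ) • W' := by
  rw [Tw, map_smulₛₗ ContinuousLinearMap.adjoint, adjoint_W, Complex.conj_ofReal]

/-- **`T_w*` is injective** (hypothesis `hTinj` of `eq47_of_type2`; v2 p.2: else `R(T)` is not dense). [folklore] -/
theorem adjoint_Tw_injective : Function.Injective (ContinuousLinearMap.adjoint Tw) := by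
  rw [adjoint_Tw]
  intro a b h
  have hc : ((1 / 10 ^ 20 : ℝ) : ℂ) ≠ 0 := by norm_num
  have h' : ((1 / 10 ^ 20 : ℝ) : ℂ) • W' a = ((1 / 10 ^ 20 : ℝ) : ℂ) • W' b := by
    simpa only [smul_apply] using h
  exact W'_injective (smul_right_injective ℓ2Z hc h')

/-- **`T_w` is one-to-one** (standing hypothesis, v2 p.2). [folklore] -/
theorem Tw_injective : Function.Injective Tw := by
  intro a b h
  have hc : ((1 / 10 ^ 20 : ℝ) : ℂ) ≠ 0 := by norm_num
  have h' : ((1 / 10 ^ 20 : ℝ) : ℂ) • W a = ((1 / 10 ^ 20 : ℝ) : ℂ) • W b := by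
    simpa only [Tw, smul_apply] using h
  exact W_injective (smul_right_injective ℓ2Z hc h')

/-- **`T_w` has dense range** (standing hypothesis, v2 p.2): `(range T_w)ᗮ = ker T_w* = 0`. [folklore] -/
theorem Tw_denseRange : DenseRange Tw := by
  have h1 : Tw.rangeᗮ = ⊥ := by
    rw [ContinuousLinearMap.orthogonal_range]
    exact LinearMap.ker_eq_bot.mpr (by exact adjoint_Tw_injective)
  have h2 : Tw.range.topologicalClosure = ⊤ := Submodule.topologicalClosure_eq_top_iff.mpr h1
  have h3 : Dense (Tw.range : Set ℓ2Z) := Submodule.dense_iff_topologicalClosure_eq_top.mpr h2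
  have h4 : (Tw.range : Set ℓ2Z) = Set.range Tw := by
    ext x
    simp only [SetLike.mem_coe, LinearMap.mem_range, Set.mem_range, ContinuousLinearMap.coe_coe]
  rw [h4] at h3
  exact h3

/-- **`T_w` is not onto** (standing hypothesis, v2 p.2). [folklore] -/
theorem Tw_not_surjective : ¬ Function.Surjective Tw := by
  intro hs
  apply W_not_surjective
  intro b
  obtain ⟨a, ha⟩ := hs b
  refine ⟨((1 / 10 ^ 20 : ℝ) : ℂ) • a, ?_⟩
  rw [map_smul, ← ha, Tw, smul_apply]

/-- **`0 ∈ σ(T_w)`** (standing hypothesis, v2 p.2: not onto ⇒ not invertible). [folklore] -/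
theorem zero_mem_spectrum_Tw : (0 : ℂ) ∈ spectrum ℂ Tw := by
  rw [spectrum.mem_iff, map_zero, zero_sub, IsUnit.neg_iff]
  intro hu
  apply Tw_not_surjective
  obtain ⟨u, hu⟩ := hu
  intro y
  refine ⟨(↑u⁻¹ : ℓ2Z →L[ℂ] ℓ2Z) y, ?_⟩
  have h := congrArg (fun S : ℓ2Z →L[ℂ] ℓ2Z => S y) u.mul_inv
  rw [hu] at h
  simpa using h

/-- Powers of `T_w` are weighted translations: `(T_w^j a)_i = c_{i,j} · a_{i+j}` for a scalar `c_{i,j}`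
(`= 10^{-20j} ω_i ω_{i+1} ⋯ ω_{i+j−1}`). [folklore] -/
theorem Tw_pow_apply (j : ℕ) (i : ℤ) : ∃ c : ℂ, ∀ a : ℓ2Z, (Tw ^ j) a i = c * a (i + j) := by
  induction j generalizing i with
  | zero => exact ⟨1, fun a => by simp⟩
  | succ j ih =>
    obtain ⟨c, hc⟩ := ih i
    refine ⟨c * (((1 / 10 ^ 20 : ℝ) : ℂ) * (ω (i + j) : ℂ)), fun a => ?_⟩
    rw [pow_succ, mul_apply_eq_comp, hc, Tw_apply, Nat.cast_succ, ← add_assoc]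
    ring

/-- `⟨e_k, T_w^j e_k⟩ = 0` for `j ≥ 1` (`T_w^j e_k` is a multiple of `e_{k−j}`). [folklore] -/
theorem inner_eZ_Tw_pow_eZ (k : ℤ) {j : ℕ} (hj : 1 ≤ j) : ⟪eZ k, (Tw ^ j) (eZ k)⟫_ℂ = 0 := by
  classical
  obtain ⟨c, hc⟩ := Tw_pow_apply j k
  unfold eZ
  rw [lp.inner_single_left, hc, lp.single_apply, Pi.single_eq_of_ne (by omega : k + (j : ℤ) ≠ k), mul_zero,
    inner_zero_right]

/-- `⟨c e_k, T_w^j (c e_k)⟩ = 0` for `j ≥ 1`. [folklore] -/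
theorem inner_smul_eZ_Tw_pow (c : ℂ) (k : ℤ) {j : ℕ} (hj : 1 ≤ j) : ⟪c • eZ k, (Tw ^ j) (c • eZ k)⟫_ℂ = 0 := by
  rw [map_smul, inner_smul_left, inner_smul_right, inner_eZ_Tw_pow_eZ k hj, mul_zero, mul_zero]

/-! ### `T_w` is of type 2 -/

/-- **`T_w` is of type 2** (v2 p.7, `Referee.Type2`): for every unit vector `u₀` there is `m ≥ 1` such that for
every `δ > 0` some `y ≠ 0` with `Re⟨u₀, y⟩ ≥ ‖y‖/100` has `|⟨T_w^j y, y⟩| ≤ δ‖y‖²` for all `j ≥ m` — take `y` a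
finite truncation of `u₀` with `‖u₀ − y‖ < 1/4`, supported in `[−R, R]`, and `m = 2R + 1`: for `j ≥ m` every
coordinate product `(T_w^j y)_i · conj? y_i = c_{i,j} y_{i+j} ȳ_i` vanishes, so `⟨T_w^j y, y⟩ = 0`. [cite: Enflo2023, v2 p.7 (definition of type 2)] -/
theorem type2_Tw : Referee.Type2 Tw := by
  classical
  intro u0 hu0
  have hsum := lp.hasSum_single (E := fun _ : ℤ => ℂ) (p := 2) (by simp) u0
  rw [HasSum, Metric.tendsto_nhds] at hsum
  obtain ⟨s₀, hs₀⟩ := (hsum (1 / 4) (by norm_num)).exists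
  set yN : ℓ2Z := ∑ k ∈ s₀, lp.single 2 k (u0 k) with hyN_def
  have hdist : ‖yN - u0‖ < 1 / 4 := by rwa [dist_eq_norm] at hs₀
  have hsupp : ∀ i, i ∉ s₀ → yN i = 0 := by
    intro i hi
    rw [hyN_def, lp.coeFn_sum, Finset.sum_apply]
    refine Finset.sum_eq_zero fun k hk => ?_
    rw [lp.single_apply, Pi.single_eq_of_ne (by rintro rfl; exact hi hk)]
  obtain ⟨R, hR⟩ : ∃ R : ℕ, ∀ k ∈ s₀, k.natAbs ≤ R :=
    ⟨s₀.sup Int.natAbs, fun k hk => Finset.le_sup (f := Int.natAbs) hk⟩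
  have hyN34 : 3 / 4 ≤ ‖yN‖ := by
    have h := norm_sub_norm_le u0 yN
    rw [hu0, norm_sub_rev] at h
    linarith
  have hyN0 : yN ≠ 0 := by
    intro h
    rw [h, norm_zero] at hyN34
    linarith
  have hangle : (1 / 100 : ℝ) * ‖yN‖ ≤ (⟪u0, yN⟫_ℂ).re := by
    have h1 : (⟪u0, yN⟫_ℂ).re = (⟪u0 - yN, yN⟫_ℂ).re + ‖yN‖ ^ 2 := by
      rw [← inner_self_eq_norm_sq (𝕜 := ℂ) yN, RCLike.re_to_complex, inner_sub_left, Complex.sub_re]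
      ring
    have h2 : |(⟪u0 - yN, yN⟫_ℂ).re| ≤ ‖u0 - yN‖ * ‖yN‖ :=
      (Complex.abs_re_le_norm _).trans (norm_inner_le_norm _ _)
    have h3 := neg_abs_le (⟪u0 - yN, yN⟫_ℂ).re
    have h4 : ‖u0 - yN‖ * ‖yN‖ ≤ 1 / 4 * ‖yN‖ := by
      gcongr
      rw [norm_sub_rev]
      exact hdist.le
    have h5 : 3 / 4 * ‖yN‖ ≤ ‖yN‖ ^ 2 := by nlinarith [norm_nonneg yN]
    rw [h1]
    linarith
  refine ⟨2 * R + 1, by omega, fun δ hδ => ⟨yN, ⟨hyN0, hangle⟩, fun j hj => ?_⟩⟩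
  have hzero : ⟪(⇑Tw)^[j] yN, yN⟫_ℂ = 0 := by
    rw [← ContinuousLinearMap.coe_pow', lp.inner_eq_tsum]
    have h0 : ∀ i, ⟪((Tw ^ j) yN) i, yN i⟫_ℂ = 0 := by
      intro i
      obtain ⟨c, hc⟩ := Tw_pow_apply j i
      rw [hc]
      by_cases hi : i ∈ s₀
      · have hij : i + (j : ℤ) ∉ s₀ := fun h => by
          have h1 := hR _ h
          have h2 := hR _ hi
          omega
        rw [hsupp _ hij, mul_zero, inner_zero_left]
      · rw [hsupp _ hi, inner_zero_right]
    simp only [h0, tsum_zero]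
  rw [hzero, norm_zero]
  positivity

/-! ### The `D = 2` data under `T_w`: (20) and weak nullity -/

/-- **(20) holds exactly, from `m = 1`**: `⟨T_w^j y, y⟩ + ⟨T_w^j s'_n, s'_n⟩ = 0` for every `j ≥ 1` and every `n`
(each of `y`, `s'_n` is a multiple of one standard unit vector). [cite: Enflo2023, v2 p.7, eq. (20)] -/
theorem eq20_term_zero {j : ℕ} (hj : 1 ≤ j) (n : ℕ) :
    ⟪exY2 (eZ 0), (Tw ^ j) (exY2 (eZ 0))⟫_ℂ + ⟪exS2 (eZ 0) eP n, (Tw ^ j) (exS2 (eZ 0) eP n)⟫_ℂ = 0 := by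
  rw [exY2, inner_smul_eZ_Tw_pow _ 0 hj, zero_add]
  rcases eq_or_ne n 0 with rfl | hn
  · rw [exS2_zero, inner_smul_eZ_Tw_pow _ 0 hj]
  · rw [exS2_of_ne_zero _ _ hn, eP_apply, inner_smul_eZ_Tw_pow _ _ hj]

/-- (20) in the limit form used by the pipeline (`eq47_of_type2`): for `j ≥ 1`,
`⟨T_w^j y, y⟩ + ⟨T_w^j s'_n, s'_n⟩ → 0` as `n → ∞` (the sequence is identically `0`). [cite: Enflo2023, v2 p.7, eq. (20)] -/
theorem eq20_model (j : ℕ) (hj : 1 ≤ j) :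
    Tendsto (fun n => ⟪exY2 (eZ 0), (Tw ^ j) (exY2 (eZ 0))⟫_ℂ +
      ⟪exS2 (eZ 0) eP n, (Tw ^ j) (exS2 (eZ 0) eP n)⟫_ℂ) atTop (𝓝 0) := by
  have h : (fun n => ⟪exY2 (eZ 0), (Tw ^ j) (exY2 (eZ 0))⟫_ℂ +
      ⟪exS2 (eZ 0) eP n, (Tw ^ j) (exS2 (eZ 0) eP n)⟫_ℂ) = fun _ => (0 : ℂ) :=
    funext fun n => eq20_term_zero hj n
  rw [h]
  exact tendsto_const_nhds

/-- **`s'_n` is weakly null**: `⟨v, s'_n⟩ = (5/13)⟨v, e_{n+1}⟩ → 0` for every `v ∈ ℓ²` (the rogue term `s'_0` is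
invisible to a limit in `n`). [folklore] -/
theorem weaklyNull_model (v : ℓ2Z) : Tendsto (fun n => ⟪v, exS2 (eZ 0) eP n⟫_ℂ) atTop (𝓝 0) := by
  classical
  have h0 : Tendsto (fun n : ℕ => v ((n : ℤ) + 1)) atTop (𝓝 0) := tendsto_apply_succ_zero v
  have h1 : Tendsto (fun n : ℕ => (5 / 13 : ℝ) * ‖v ((n : ℤ) + 1)‖) atTop (𝓝 0) := by
    have h := (tendsto_zero_iff_norm_tendsto_zero.1 h0).const_mul (5 / 13 : ℝ)
    simpa using h
  refine squeeze_zero_norm' ?_ h1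
  filter_upwards [eventually_ge_atTop 1] with n hn
  rw [exS2_of_ne_zero _ _ (by omega), inner_smul_right, eP_apply, eZ, lp.inner_single_right, norm_mul,
    Complex.norm_real, Real.norm_of_nonneg (by norm_num : (0 : ℝ) ≤ 5 / 13)]
  gcongr
  calc ‖⟪v ((n : ℤ) + 1), (1 : ℂ)⟫_ℂ‖ ≤ ‖v ((n : ℤ) + 1)‖ * ‖(1 : ℂ)‖ := norm_inner_le_norm _ _
    _ = ‖v ((n : ℤ) + 1)‖ := by simp

/-! ### Everything the pipeline asks, and the printed (47) still fails -/

/-- **D19 closed on a genuine type-2 operator obeying every standing hypothesis of v2 pp.1–2.**  For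
`T_w = 10⁻²⁰·W` on `ℓ²(ℤ)` (`W` the weighted bilateral shift above) with `u₀ = x₀ = e_0` and the data
`y = (12/13) e_0`, `s'_0 = −(25/13) e_0`, `s'_n = (5/13) e_{n+1}`:
(i) the standing hypotheses of v2 pp.1–2 and the hypotheses of `Type2.eq47_of_type2` hold — `T_w` one-to-one, not
onto, with dense range, `0 ∈ σ(T_w)`, `‖T_w‖ = 10⁻²⁰` (so `‖T_w‖ < 1`, `‖T_w‖ ≤ 1/10`), `T_w*` injective, `T_w` of
type 2, `‖e_0‖ = 1`;
(ii) every data conjunct of its second disjunct holds with `m = 1` — `y ≠ 0`, `‖y‖ ≤ 1`, `Re⟨u₀, y⟩ ≥ 1/100`,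
`‖s'_n‖ ≤ 2`, `s'` weakly null, (20) for all `j ≥ 1`;
(iii) the PRINTED threshold (`MovesBounded`, all `n`) is exactly `L₀ = 12/25`, with `M(L₀) = ∞`;
(iv) the printed conclusion of (47) fails: no `c = 1/8`-small `(εθ)` at any index for any `δ ≤ 1/10`, indeed
`(εθ) ≥ 1/8` for every minimal move of `y + L₀ s'_n` at every index and every radius in `[0.3, 0.4]`.
[cite: Enflo2023, v2 p.22, (47); refuted as printed, inside the type-2 pipeline] -/
theorem inPipeline_printed_eq47_fails :
    (Function.Injective Tw ∧ ¬ Function.Surjective Tw ∧ DenseRange Tw ∧ (0 : ℂ) ∈ spectrum ℂ Tw ∧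
      ‖Tw‖ = 1 / 10 ^ 20 ∧ ‖Tw‖ < 1 ∧ ‖Tw‖ ≤ 1 / 10 ∧ Function.Injective (ContinuousLinearMap.adjoint Tw) ∧
      Referee.Type2 Tw ∧ ‖eZ 0‖ = 1) ∧
    (exY2 (eZ 0) ≠ 0 ∧ ‖exY2 (eZ 0)‖ ≤ 1 ∧ (1 / 100 : ℝ) ≤ re ⟪eZ 0, exY2 (eZ 0)⟫_ℂ ∧
      (∀ n, ‖exS2 (eZ 0) eP n‖ ≤ 2) ∧
      (∀ v : ℓ2Z, Tendsto (fun n => ⟪v, exS2 (eZ 0) eP n⟫_ℂ) atTop (𝓝 0)) ∧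
      (∀ j, 1 ≤ j → Tendsto (fun n => ⟪exY2 (eZ 0), (Tw ^ j) (exY2 (eZ 0))⟫_ℂ +
        ⟪exS2 (eZ 0) eP n, (Tw ^ j) (exS2 (eZ 0) eP n)⟫_ℂ) atTop (𝓝 0))) ∧
    ((∀ L, 0 < L → L < 12 / 25 → MovesBounded Tw norm_Tw_lt_one (eZ 0) (exY2 (eZ 0)) (exS2 (eZ 0) eP) L) ∧
      ∀ δ > 0, ∃ L, 12 / 25 ≤ L ∧ L < 12 / 25 + δ ∧ 0 < L ∧
        ¬ MovesBounded Tw norm_Tw_lt_one (eZ 0) (exY2 (eZ 0)) (exS2 (eZ 0) eP) L) ∧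
    (∀ L₀ : ℝ, (∀ L, 0 < L → L < L₀ → MovesBounded Tw norm_Tw_lt_one (eZ 0) (exY2 (eZ 0)) (exS2 (eZ 0) eP) L) →
      (∀ δ > 0, ∃ L, L₀ ≤ L ∧ L < L₀ + δ ∧ 0 < L ∧
        ¬ MovesBounded Tw norm_Tw_lt_one (eZ 0) (exY2 (eZ 0)) (exS2 (eZ 0) eP) L) →
      L₀ = 12 / 25) ∧
    ¬ MovesBounded Tw norm_Tw_lt_one (eZ 0) (exY2 (eZ 0)) (exS2 (eZ 0) eP) (12 / 25) ∧
    ¬ (∀ c > 0, ∀ δ > 0, ∀ N : ℕ, ∃ n, N ≤ n ∧ ∃ r : ℝ, 3 / 10 ≤ r ∧ r ≤ 3 / 10 + δ ∧ ∃ a : Vy.ℓ2,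
        IsMinimal (Vy.V Tw norm_Tw_lt_one (exY2 (eZ 0) + ((12 / 25 : ℝ) : ℂ) • exS2 (eZ 0) eP n)) (eZ 0) r a ∧
        0 ≤ re ⟪eZ 0 - Vy.V Tw norm_Tw_lt_one (exY2 (eZ 0) + ((12 / 25 : ℝ) : ℂ) • exS2 (eZ 0) eP n) a,
          Vy.V Tw norm_Tw_lt_one (exY2 (eZ 0) + ((12 / 25 : ℝ) : ℂ) • exS2 (eZ 0) eP n) a⟫_ℂ ∧
        re ⟪eZ 0 - Vy.V Tw norm_Tw_lt_one (exY2 (eZ 0) + ((12 / 25 : ℝ) : ℂ) • exS2 (eZ 0) eP n) a,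
          Vy.V Tw norm_Tw_lt_one (exY2 (eZ 0) + ((12 / 25 : ℝ) : ℂ) • exS2 (eZ 0) eP n) a⟫_ℂ < c) ∧
    ∀ (n : ℕ) (r : ℝ) (a : Vy.ℓ2), 3 / 10 ≤ r → r ≤ 2 / 5 →
      IsMinimal (Vy.V Tw norm_Tw_lt_one (exY2 (eZ 0) + ((12 / 25 : ℝ) : ℂ) • exS2 (eZ 0) eP n)) (eZ 0) r a →
      1 / 8 ≤ re ⟪eZ 0 - Vy.V Tw norm_Tw_lt_one (exY2 (eZ 0) + ((12 / 25 : ℝ) : ℂ) • exS2 (eZ 0) eP n) a,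
        Vy.V Tw norm_Tw_lt_one (exY2 (eZ 0) + ((12 / 25 : ℝ) : ℂ) • exS2 (eZ 0) eP n) a⟫_ℂ := by
  obtain ⟨⟨hy0, hy1, hre, hs2⟩, hthr, huniq, hnot, h47, hge⟩ :=
    printed_eq47_fails_D2 Tw norm_Tw_lt_one norm_Tw_le_tenth (norm_eZ 0) (e := eP) norm_eP inner_eZ_zero_eP
  exact ⟨⟨Tw_injective, Tw_not_surjective, Tw_denseRange, zero_mem_spectrum_Tw, norm_Tw, norm_Tw_lt_one,
      norm_Tw_le_tenth, adjoint_Tw_injective, type2_Tw, norm_eZ 0⟩,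
    ⟨hy0, hy1, hre, hs2, weaklyNull_model, eq20_model⟩, hthr, huniq, hnot, h47, hge⟩

end ShiftModel

end Type2

end Literature.Analysis.OperatorTheory.Enflo2023
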